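import Summits.BirchSwinnertonDyer.BirchSwinnertonDyer.Theorems.InertBadSignedBranchesInertBadAtThreeQuarticTorsionSums
import HarnessLib

/-!
# The quarter-point rung of the quartic `3`-torsion sums, in the `3^{3/4}` / `3^{1/4}` currency (plan P4.3/P4.4 verbatim)

Summit `BirchSwinnertonDyer`, crux `InertBadAtThree` (stmt-BirchSwinnertonDyer-19225), line of record `rubin_e1_inert_three`; sequel
to `…InertBadAtThreeQuarticTorsionSums`, whose `quarticSum_quarter` / `quarticConjSum_quarter` give the values of the `χ₄`- and
`χ̄₄`-twisted `3`-torsion sums of `E₁*` at the `4`-torsion point `w = 1/4` of `ℂ/(ℤi + ℤ)` in algebraic form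
(`−3√2(√3−1)℘(1/3)/ϖ₀`, `−(2+√2)(3−√3)℘(1/3)/ϖ₀`). Here they are converted into the currency of the stub plan
`Cruxes/InertBadAtThree/STUB-PLAN-neronIntegralThreeQuartic-bsd-idea-18-g8.md` (pieces **P4.3 `stub_quarticSum_quarter`,
P4.4 `stub_quarticConjSum_quarter`**, statements token-identical up to unfolding the plan's abbreviations):

* `quarticSum_quarter_cpow` — `∑_v χ₄(3v) E₁*(1/4 + v) = −2 · 3^{3/4} · ϖ₀`,
* `quarticConjSum_quarter_cpow` — `∑_v χ̄₄(3v) E₁*(1/4 + v) = −2(1 + √2) · 3^{1/4} · ϖ₀`,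

with `3^{3/4} = (3 : ℂ) ^ ((3 : ℂ)/4)` (principal branch = the positive real `3^{3/4}`): the key real identities
`3(√3 − 1)·√((3+2√3)/3) = √2·3^{3/4}` and `(3 − √3)·√((3+2√3)/3) = √2·3^{1/4}` (`real_constant_three_quarters`,
`real_constant_one_quarter`; both sides positive with equal fourth powers `108`, `12`), and `℘(1/3) = √((3+2√3)/3)·ϖ₀²`
(`weierstrassP_third_eq`). So the `3`-adic bounds `3/4` and `1/4` of `…QuarticTorsionIntegrality` are ATTAINED at `w = 1/4` — the
"first rung" / cheapest exact falsifier of the plan (§1, §6(a)). Width seat bsd-wall-cm-bed-w1 g7.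

HONEST FRAMING: identities between special values only; nothing here proves the registered stub, the crux, any instance of F-es-18, or BSD.
No definitions, no named facts; axioms standard.
-/

set_option linter.dupNamespace false

noncomputable section

open Complex PeriodPair Real Set Filter
open scoped Real Topology PeriodPair ComplexConjugate

namespace Summit.BirchSwinnertonDyer.BirchSwinnertonDyer.Theorems.InertBadSignedBranchesInertBadAtThreeQuarticQuarterRung

open Literature.NumberTheory.EllipticCurves Literature.NumberTheory.EllipticCurves.GaussianLattice
open Summit.BirchSwinnertonDyer.BirchSwinnertonDyer.Theorems.InertBadSignedBranchesInertBadAtThreeQuarticTorsionSums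

/-- **`3(√3 − 1)·√((3+2√3)/3) = √2·3^{3/4}`** in `ℝ`: both sides are positive and their fourth powers are `108`. -/
theorem real_constant_three_quarters :
    3 * (Real.sqrt 3 - 1) * Real.sqrt ((3 + 2 * Real.sqrt 3) / 3) = Real.sqrt 2 * (3 : ℝ) ^ ((3 : ℝ) / 4) := by
  set s := Real.sqrt 3 with hs
  set p := Real.sqrt ((3 + 2 * Real.sqrt 3) / 3) with hp
  have hs2 : s ^ 2 = 3 := Real.sq_sqrt (by norm_num)
  have hs1 : 1 < s := by
    rw [hs, show (1 : ℝ) = Real.sqrt 1 from Real.sqrt_one.symm]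
    exact Real.sqrt_lt_sqrt (by norm_num) (by norm_num)
  have hp0 : 0 < p := Real.sqrt_pos.mpr (by positivity)
  have hp2 : p ^ 2 = (3 + 2 * s) / 3 := by rw [hp, hs, Real.sq_sqrt (by positivity)]
  have hr2 : Real.sqrt 2 ^ 2 = 2 := Real.sq_sqrt (by norm_num)
  have ha : 0 ≤ 3 * (s - 1) * p := by nlinarith
  have hb : 0 ≤ Real.sqrt 2 * (3 : ℝ) ^ ((3 : ℝ) / 4) := by positivity
  refine (pow_left_inj₀ ha hb (by norm_num : (4 : ℕ) ≠ 0)).mp ?_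
  have h4 : ((3 : ℝ) ^ ((3 : ℝ) / 4)) ^ 4 = 27 := by
    rw [← Real.rpow_mul_natCast (by norm_num : (0 : ℝ) ≤ 3)]
    norm_num
  have hp4 : p ^ 4 = ((3 + 2 * s) / 3) ^ 2 := by rw [← hp2]; ring
  rw [show (Real.sqrt 2 * (3 : ℝ) ^ ((3 : ℝ) / 4)) ^ 4 = (Real.sqrt 2 ^ 2) ^ 2 * ((3 : ℝ) ^ ((3 : ℝ) / 4)) ^ 4 by ring,
    h4, hr2, show (3 * (s - 1) * p) ^ 4 = 81 * (s - 1) ^ 4 * p ^ 4 by ring, hp4]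
  linear_combination (36 * s ^ 4 - 36 * s ^ 3 - 27 * s ^ 2 + 72 * s + 9) * hs2

/-- **`(3 − √3)·√((3+2√3)/3) = √2·3^{1/4}`** in `ℝ`: both sides are positive and their fourth powers are `12`. -/
theorem real_constant_one_quarter :
    (3 - Real.sqrt 3) * Real.sqrt ((3 + 2 * Real.sqrt 3) / 3) = Real.sqrt 2 * (3 : ℝ) ^ ((1 : ℝ) / 4) := by
  set s := Real.sqrt 3 with hs
  set p := Real.sqrt ((3 + 2 * Real.sqrt 3) / 3) with hp
  have hs2 : s ^ 2 = 3 := Real.sq_sqrt (by norm_num)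
  have hs3 : s < 3 := by
    rw [hs, show (3 : ℝ) = Real.sqrt 9 by rw [show (9 : ℝ) = 3 ^ 2 by norm_num, Real.sqrt_sq (by norm_num)]]
    exact Real.sqrt_lt_sqrt (by norm_num) (by norm_num)
  have hp0 : 0 < p := Real.sqrt_pos.mpr (by positivity)
  have hp2 : p ^ 2 = (3 + 2 * s) / 3 := by rw [hp, hs, Real.sq_sqrt (by positivity)]
  have hr2 : Real.sqrt 2 ^ 2 = 2 := Real.sq_sqrt (by norm_num)
  have ha : 0 ≤ (3 - s) * p := by nlinarith
  have hb : 0 ≤ Real.sqrt 2 * (3 : ℝ) ^ ((1 : ℝ) / 4) := by positivity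
  refine (pow_left_inj₀ ha hb (by norm_num : (4 : ℕ) ≠ 0)).mp ?_
  have h4 : ((3 : ℝ) ^ ((1 : ℝ) / 4)) ^ 4 = 3 := by
    rw [← Real.rpow_mul_natCast (by norm_num : (0 : ℝ) ≤ 3)]
    norm_num
  have hp4 : p ^ 4 = ((3 + 2 * s) / 3) ^ 2 := by rw [← hp2]; ring
  rw [show (Real.sqrt 2 * (3 : ℝ) ^ ((1 : ℝ) / 4)) ^ 4 = (Real.sqrt 2 ^ 2) ^ 2 * ((3 : ℝ) ^ ((1 : ℝ) / 4)) ^ 4 by ring,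
    h4, hr2, show ((3 - s) * p) ^ 4 = (3 - s) ^ 4 * p ^ 4 by ring, hp4]
  linear_combination (1 / 9 * (4 * s ^ 4 - 36 * s ^ 3 + 93 * s ^ 2 - 207)) * hs2

/-- `ϖ₀ ≠ 0` in `ℂ`. -/
private theorem varpi_ne_zero' : ((Real.Gamma (1 / 4) ^ 2 / (2 * Real.sqrt (2 * π)) : ℝ) : ℂ) ≠ 0 :=
  Complex.ofReal_ne_zero.mpr varpi_pos.ne'

/-- **P4.3 — `∑_v χ₄(3v) E₁*(1/4 + v) = −2·3^{3/4}·ϖ₀`** (plan `stub_quarticSum_quarter`, statement verbatim up to unfolding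
`threeTorsionQuarticSum` and the `ϖ₀` notation): from `quarticSum_quarter` (`= −3√2(√3−1)℘(1/3)/ϖ₀`), `weierstrassP_third_eq`
and `real_constant_three_quarters`. -/
theorem quarticSum_quarter_cpow :
    (kroneckerE₁ ((1 / 4 : ℂ) + 1 / 3) + kroneckerE₁ ((1 / 4 : ℂ) - 1 / 3) -
      (kroneckerE₁ ((1 / 4 : ℂ) + I / 3) + kroneckerE₁ ((1 / 4 : ℂ) - I / 3)) -
      I * (kroneckerE₁ ((1 / 4 : ℂ) + (1 + I) / 3) + kroneckerE₁ ((1 / 4 : ℂ) - (1 + I) / 3)) +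
      I * (kroneckerE₁ ((1 / 4 : ℂ) + (1 - I) / 3) + kroneckerE₁ ((1 / 4 : ℂ) - (1 - I) / 3))) =
      -2 * (3 : ℂ) ^ ((3 : ℂ) / 4) * ((Real.Gamma (1 / 4) ^ 2 / (2 * Real.sqrt (2 * π)) : ℝ) : ℂ) := by
  have hr2 : Real.sqrt 2 ^ 2 = 2 := Real.sq_sqrt (by norm_num)
  have r2 : 3 * Real.sqrt 2 * (Real.sqrt 3 - 1) * Real.sqrt ((3 + 2 * Real.sqrt 3) / 3) =
      2 * (3 : ℝ) ^ ((3 : ℝ) / 4) := by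
    linear_combination Real.sqrt 2 * real_constant_three_quarters + (3 : ℝ) ^ ((3 : ℝ) / 4) * hr2
  have key : 3 * (Real.sqrt 2 : ℂ) * ((Real.sqrt 3 : ℂ) - 1) * (Real.sqrt ((3 + 2 * Real.sqrt 3) / 3) : ℂ) =
      2 * (3 : ℂ) ^ ((3 : ℂ) / 4) := by
    have h := congrArg (fun x : ℝ ↦ (x : ℂ)) r2
    simp only [Complex.ofReal_mul, Complex.ofReal_sub, Complex.ofReal_one, Complex.ofReal_ofNat] at h
    rw [h, Complex.ofReal_cpow (by norm_num : (0 : ℝ) ≤ 3)]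
    push_cast
    ring_nf
  rw [quarticSum_quarter, weierstrassP_third_eq, Complex.ofReal_mul, Complex.ofReal_pow]
  set ϖ : ℂ := ((Real.Gamma (1 / 4) ^ 2 / (2 * Real.sqrt (2 * π)) : ℝ) : ℂ) with hϖ
  have hϖ0 : ϖ ≠ 0 := varpi_ne_zero'
  have e : 3 * (Real.sqrt 2 : ℂ) * ((Real.sqrt 3 : ℂ) - 1) * ((Real.sqrt ((3 + 2 * Real.sqrt 3) / 3) : ℂ) * ϖ ^ 2) / ϖ =
      (3 * (Real.sqrt 2 : ℂ) * ((Real.sqrt 3 : ℂ) - 1) * (Real.sqrt ((3 + 2 * Real.sqrt 3) / 3) : ℂ)) * ϖ := by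
    rw [div_eq_iff hϖ0]; ring
  rw [e, key]
  ring

/-- **P4.4 — `∑_v χ̄₄(3v) E₁*(1/4 + v) = −2(1+√2)·3^{1/4}·ϖ₀`** (plan `stub_quarticConjSum_quarter` verbatim up to unfolding): from
`quarticConjSum_quarter` (`= −(2+√2)(3−√3)℘(1/3)/ϖ₀`), `weierstrassP_third_eq`, `real_constant_one_quarter` and `2 + √2 = √2(1 + √2)`. -/
theorem quarticConjSum_quarter_cpow :
    (kroneckerE₁ ((1 / 4 : ℂ) + 1 / 3) + kroneckerE₁ ((1 / 4 : ℂ) - 1 / 3) -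
      (kroneckerE₁ ((1 / 4 : ℂ) + I / 3) + kroneckerE₁ ((1 / 4 : ℂ) - I / 3)) +
      I * (kroneckerE₁ ((1 / 4 : ℂ) + (1 + I) / 3) + kroneckerE₁ ((1 / 4 : ℂ) - (1 + I) / 3)) -
      I * (kroneckerE₁ ((1 / 4 : ℂ) + (1 - I) / 3) + kroneckerE₁ ((1 / 4 : ℂ) - (1 - I) / 3))) =
      -2 * (1 + (Real.sqrt 2 : ℂ)) * (3 : ℂ) ^ ((1 : ℂ) / 4) *
        ((Real.Gamma (1 / 4) ^ 2 / (2 * Real.sqrt (2 * π)) : ℝ) : ℂ) := by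
  have hr2 : Real.sqrt 2 ^ 2 = 2 := Real.sq_sqrt (by norm_num)
  have r2 : (2 + Real.sqrt 2) * (3 - Real.sqrt 3) * Real.sqrt ((3 + 2 * Real.sqrt 3) / 3) =
      2 * (1 + Real.sqrt 2) * (3 : ℝ) ^ ((1 : ℝ) / 4) := by
    linear_combination (2 + Real.sqrt 2) * real_constant_one_quarter + (3 : ℝ) ^ ((1 : ℝ) / 4) * hr2
  have key : (2 + (Real.sqrt 2 : ℂ)) * (3 - (Real.sqrt 3 : ℂ)) * (Real.sqrt ((3 + 2 * Real.sqrt 3) / 3) : ℂ) =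
      2 * (1 + (Real.sqrt 2 : ℂ)) * (3 : ℂ) ^ ((1 : ℂ) / 4) := by
    have h := congrArg (fun x : ℝ ↦ (x : ℂ)) r2
    simp only [Complex.ofReal_mul, Complex.ofReal_sub, Complex.ofReal_add, Complex.ofReal_one,
      Complex.ofReal_ofNat] at h
    rw [h, Complex.ofReal_cpow (by norm_num : (0 : ℝ) ≤ 3)]
    push_cast
    ring_nf
  rw [quarticConjSum_quarter, weierstrassP_third_eq, Complex.ofReal_mul, Complex.ofReal_pow]
  set ϖ : ℂ := ((Real.Gamma (1 / 4) ^ 2 / (2 * Real.sqrt (2 * π)) : ℝ) : ℂ) with hϖ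
  have hϖ0 : ϖ ≠ 0 := varpi_ne_zero'
  have e : (2 + (Real.sqrt 2 : ℂ)) * (3 - (Real.sqrt 3 : ℂ)) * ((Real.sqrt ((3 + 2 * Real.sqrt 3) / 3) : ℂ) * ϖ ^ 2) / ϖ =
      ((2 + (Real.sqrt 2 : ℂ)) * (3 - (Real.sqrt 3 : ℂ)) * (Real.sqrt ((3 + 2 * Real.sqrt 3) / 3) : ℂ)) * ϖ := by
    rw [div_eq_iff hϖ0]; ring
  rw [e, key]
  ring

end Summit.BirchSwinnertonDyer.BirchSwinnertonDyer.Theorems.InertBadSignedBranchesInertBadAtThreeQuarticQuarterRung
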